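import Summits.ValiantsHypothesis.ValiantsHypothesis.Theorems.FermionicJetQuadraticDcCdetPermSumsTwo
import Literature.Computability.AlgebraicComplexity.HessianRank
import Literature.Computability.AlgebraicComplexity.MignonRessayreBound

/-!
# Route `FermionicJet`, crux `QuadraticDcCdet` (stmt-ValiantsHypothesis-5343) — helper 3:
# the Hessian of `cdet` at an all-ones matrix with one modified entry

For a finite index type `ι`, two indices `p ≠ q` and a scalar `s`, let `x_s ∈ k^{ι × ι}` be the
matrix with `x_s(p, q) = 1 + s` and all other entries `1`.  We prove (`c` = `numCycles`,
`K_j = Σ_{𝔖_j} sgn·c`, `Z_j = Σ_{𝔖_j} sgn`, `|ι| = m + 3`):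

* `pderiv_pderiv_cdetPoly`, `hessianMatrix_cdetPoly_apply`:
  `∂_{cd} ∂_{ab} cdet = Σ_{π : π b = a, π d = c, b ≠ d} sgn π c(π) ∏_{i ≠ b,d} X_{π i, i}`;
* `prod_onePlus` : `∏_{i ∈ S} x_s(π i, i) = 1 + s` if `q ∈ S` and `π q = p`, else `1`;
* `eval_cdetPoly_onePlus` : `cdet(x_s) = (-1)^{m+1} m! (m + 1 + s)`, so `x_{-(m+1)}` — the all-ones
  matrix with the `(p, q)` entry replaced by `3 - n`, `n = |ι|` — lies on the hypersurface
  `{cdet = 0}` (`eval_cdetPoly_onePlus_eq_zero`);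
* `hessianMatrix_cdetPoly_onePlus_apply` : the entry `((c,d),(a,b))` of the Hessian of `cdet` at
  `x_s` is `0` if `b = d` or `a = c`, and otherwise
  `W(a,b,c,d; m+1) - s · [q ∉ {b,d}] [p ∉ {a,c}] · W(ρa, b, ρc, d; m)`, where `ρ q = p`, `ρ = id`
  otherwise (contraction of the arc `q → p`), and `W(a,b,c,d; j) = ε_K K_j + ε_Z Z_j` is the
  two-prescribed-values sum of helper 2 (`ε_K = 1` for the patterns `a = b ∧ c = d` and
  "no coincidence", `-1` otherwise; `ε_Z ∈ {2, -1, 0}`).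

For `m ≥ 2` (`n ≥ 5`) all `Z`'s vanish and the Hessian at `x_{2-n}` is `(-1)^m (m-2)!` times the
integer matrix `-(m-1) ε_K(a,b,c,d) + (m+1) [q ∉ {b,d}] [p ∉ {a,c}] ε_K(ρa,b,ρc,d)` whose
nonsingularity (helpers 4–5) gives `n² ≤ 2 · dc(cdet_n)` via
`rank_hessianMatrix_le_two_mul_determinantalComplexity`.
HONEST FRAMING: a quadratic Mignon–Ressayre-type lower bound for the cycle-counting determinant of
a dormant route; nothing here bears on `VP ≠ VNP`, which is NOT proved.
-/

noncomputable section

open MvPolynomial Equiv Equiv.Perm Finset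

-- layout Summits/ValiantsHypothesis/ValiantsHypothesis forces the duplicated namespace component
set_option linter.dupNamespace false

namespace Summit.ValiantsHypothesis.ValiantsHypothesis.Theorems.FermionicJet.CdetHessian

open Literature.Computability.AlgebraicComplexity
open Summit.ValiantsHypothesis.ValiantsHypothesis.Theorems.FermionicJet.NumCyclesSums

universe u v

variable {k : Type u} [CommRing k] {ι : Type v} [Fintype ι] [DecidableEq ι]

/-! ### Second partial derivatives of `cdet` -/

omit [Fintype ι] in
/-- `∂/∂X_{ab}` of a permutation monomial `∏_{i ∈ S} X_{π i, i}` over an arbitrary finite index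
type: `∏_{i ∈ S, i ≠ b} X_{π i, i}` if `b ∈ S` and `π b = a`, else `0`. -/
theorem pderiv_prod_X_perm_finset (S : Finset ι) (π : Perm ι) (a b : ι) :
    pderiv (a, b) (∏ i ∈ S, (X (π i, i) : MvPolynomial (ι × ι) k)) =
      if b ∈ S ∧ π b = a then ∏ i ∈ S.erase b, X (π i, i) else 0 := by
  classical
  rw [pderiv_finset_prod]
  simp only [pderiv_X]
  by_cases h : b ∈ S ∧ π b = a
  · rw [if_pos h, Finset.sum_eq_single_of_mem b h.1]
    · rw [show ((π b, b) : ι × ι) = (a, b) from Prod.ext h.2 rfl, Pi.single_eq_same, mul_one]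
    · intro i _ hib
      rw [Pi.single_eq_of_ne (fun h' => hib (congrArg Prod.snd h')), mul_zero]
  · rw [if_neg h]
    refine Finset.sum_eq_zero fun i hi => ?_
    rw [Pi.single_eq_of_ne, mul_zero]
    intro h'
    obtain ⟨h1, h2⟩ := Prod.ext_iff.mp h'
    dsimp only at h1 h2
    subst h2
    exact h ⟨hi, h1⟩

/-- Second partial derivatives of a permutation monomial:
`∂_{cd} ∂_{ab} ∏ᵢ X_{π i, i} = ∏_{i ≠ b, d} X_{π i, i}` if `π b = a`, `π d = c`, `b ≠ d`, else `0`. -/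
theorem pderiv_pderiv_prod_X_perm_univ (π : Perm ι) (a b c d : ι) :
    pderiv (c, d) (pderiv (a, b) (∏ i, (X (π i, i) : MvPolynomial (ι × ι) k))) =
      if π b = a ∧ d ≠ b ∧ π d = c then ∏ i ∈ (Finset.univ.erase b).erase d, X (π i, i)
      else 0 := by
  rw [pderiv_prod_X_perm_finset]
  by_cases h1 : π b = a
  · rw [if_pos ⟨Finset.mem_univ b, h1⟩, pderiv_prod_X_perm_finset]
    by_cases h2 : d ≠ b ∧ π d = c
    · rw [if_pos ⟨Finset.mem_erase.mpr ⟨h2.1, Finset.mem_univ d⟩, h2.2⟩, if_pos ⟨h1, h2⟩]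
    · rw [if_neg, if_neg]
      · exact fun h => h2 h.2
      · exact fun h => h2 ⟨(Finset.mem_erase.mp h.1).1, h.2⟩
  · rw [if_neg (fun h => h1 h.2), map_zero, if_neg (fun h => h1 h.1)]

/-- **Second partial derivatives of the cycle-counting determinant**:
`∂_{cd} ∂_{ab} cdet = Σ_{π : π b = a, π d = c, b ≠ d} C(sgn π · c(π)) ∏_{i ≠ b, d} X_{π i, i}`. -/
theorem pderiv_pderiv_cdetPoly (a b c d : ι) :
    pderiv (c, d) (pderiv (a, b) (cdetPoly ι k)) = ∑ π : Perm ι,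
      if π b = a ∧ d ≠ b ∧ π d = c then
        C ((((Perm.sign π : ℤ) * ((π.numCycles : ℕ) : ℤ)) : ℤ) : k) *
          ∏ i ∈ (Finset.univ.erase b).erase d, X (π i, i)
      else 0 := by
  rw [cdetPoly, map_sum, map_sum]
  refine Finset.sum_congr rfl fun π _ => ?_
  rw [pderiv_C_mul, pderiv_C_mul, pderiv_pderiv_prod_X_perm_univ]
  split_ifs <;> simp

/-- **The Hessian of `cdet` at a point**, entry by entry:
`Hess cdet (x)_{(c,d),(a,b)} = Σ_{π : π b = a, π d = c, b ≠ d} sgn π c(π) ∏_{i ≠ b,d} x_{π i, i}`. -/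
theorem hessianMatrix_cdetPoly_apply (x : ι × ι → k) (a b c d : ι) :
    hessianMatrix (cdetPoly ι k) x (c, d) (a, b) = ∑ π : Perm ι,
      if π b = a ∧ d ≠ b ∧ π d = c then
        ((Perm.sign π : ℤ) : k) * (π.numCycles : k) *
          ∏ i ∈ (Finset.univ.erase b).erase d, x (π i, i)
      else 0 := by
  rw [hessianMatrix_apply, pderiv_pderiv_cdetPoly, map_sum]
  refine Finset.sum_congr rfl fun π _ => ?_
  split_ifs
  · simp only [map_mul, eval_C, map_prod, eval_X, Int.cast_mul, Int.cast_natCast]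
  · simp

/-! ### The point: all ones, except `1 + s` at `(p, q)` -/

omit [Fintype ι] in
/-- A product of entries of the point along a partial permutation picks up the factor `1 + s`
exactly when it passes through the `(p, q)` entry. -/
theorem prod_onePlus (p q : ι) (s : k) (S : Finset ι) (π : Perm ι) :
    (∏ i ∈ S, if (π i, i) = (p, q) then 1 + s else (1 : k)) =
      if q ∈ S ∧ π q = p then 1 + s else 1 := by
  have hval : ∀ i, (if (π i, i) = (p, q) then 1 + s else (1 : k)) =
      if i = q ∧ π q = p then 1 + s else 1 := by
    intro i
    simp only [Prod.mk.injEq]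
    by_cases hi : i = q
    · subst hi; simp [and_comm]
    · rw [if_neg (fun h => hi h.2), if_neg (fun h => hi h.1)]
  simp_rw [hval]
  by_cases h : q ∈ S ∧ π q = p
  · rw [if_pos h, Finset.prod_eq_single_of_mem q h.1]
    · rw [if_pos ⟨rfl, h.2⟩]
    · intro i _ hi
      rw [if_neg (fun h' => hi h'.1)]
  · rw [if_neg h]
    refine Finset.prod_eq_one fun i hi => ?_
    rw [if_neg]
    rintro ⟨rfl, h2⟩
    exact h ⟨hi, h2⟩

/-- **`cdet` at the point**: `cdet(x_s) = K_{m+3} - s K_{m+2} = (-1)^{m+1} · m! · (m + 1 + s)` on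
`|ι| = m + 3` indices (all of `𝔖_ι`, plus `s` times the permutations through the arc `q → p`). -/
theorem eval_cdetPoly_onePlus {m : ℕ} (hι : Fintype.card ι = m + 3) {p q : ι} (hpq : p ≠ q)
    (s : k) :
    eval (fun ij : ι × ι => if ij = (p, q) then 1 + s else (1 : k)) (cdetPoly ι k) =
      (-1) ^ (m + 1) * (m.factorial : k) * ((m : k) + 1 + s) := by
  have hsum : eval (fun ij : ι × ι => if ij = (p, q) then 1 + s else (1 : k)) (cdetPoly ι k) =
      ∑ π : Perm ι, (((Perm.sign π : ℤ) : k) * (π.numCycles : k) +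
        s * (if π q = p then ((Perm.sign π : ℤ) : k) * (π.numCycles : k) else 0)) := by
    rw [cdetPoly, map_sum]
    refine Finset.sum_congr rfl fun π _ => ?_
    simp only [map_mul, eval_C, map_prod, eval_X, Int.cast_mul, Int.cast_natCast]
    rw [prod_onePlus p q s]
    simp only [Finset.mem_univ, true_and]
    split_ifs <;> ring
  rw [hsum, Finset.sum_add_distrib, ← Finset.mul_sum,
    sum_sign_mul_numCycles_eq (m + 3) ι hι, sum_sign_mul_numCycles_apply_eq p q, if_neg hpq,
    if_neg hpq, zero_mul, add_zero,
    sum_sign_mul_numCycles_eq (m + 2) {y // y ≠ q} (by rw [card_subtype_ne, hι]; omega),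
    if_neg (by omega), if_neg (by omega), show m + 3 - 2 = m + 1 from rfl,
    show m + 2 - 2 = m from rfl, Nat.factorial_succ, pow_succ, pow_succ]
  push_cast
  ring

/-- **The point lies on the hypersurface**: with `s = -(m+1)`, i.e. the `(p, q)` entry equal to
`-m = 3 - |ι|`, `cdet(x_s) = 0`. -/
theorem eval_cdetPoly_onePlus_eq_zero {m : ℕ} (hι : Fintype.card ι = m + 3) {p q : ι}
    (hpq : p ≠ q) :
    eval (fun ij : ι × ι => if ij = (p, q) then 1 + (-((m : k) + 1)) else (1 : k))
      (cdetPoly ι k) = 0 := by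
  rw [eval_cdetPoly_onePlus hι hpq]; ring

/-! ### The Hessian at the point -/

/-- **The Hessian of `cdet` at the point**, split along the `(p, q)` entry:
`Hess_{(c,d),(a,b)} = [b ≠ d] Σ_{π b = a, π d = c} sgn·c + s·[b ≠ d][q ∉ {b,d}] Σ_{π b = a, π d = c,
π q = p} sgn·c`. -/
theorem hessianMatrix_cdetPoly_onePlus_eq_sum (p q : ι) (s : k) (a b c d : ι) :
    hessianMatrix (cdetPoly ι k) (fun ij : ι × ι => if ij = (p, q) then 1 + s else (1 : k))
        (c, d) (a, b) =
      (if b = d then 0 else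
        ∑ π : Perm ι, if π b = a ∧ π d = c then ((Perm.sign π : ℤ) : k) * (π.numCycles : k)
          else 0) +
      s * (if b = d ∨ q = b ∨ q = d then 0 else
        ∑ π : Perm ι, if π b = a ∧ π d = c ∧ π q = p then
          ((Perm.sign π : ℤ) : k) * (π.numCycles : k) else 0) := by
  rw [hessianMatrix_cdetPoly_apply]
  simp_rw [prod_onePlus p q s]
  have hmem : (q ∈ (Finset.univ.erase b).erase d) ↔ (q ≠ d ∧ q ≠ b) := by simp
  simp_rw [hmem]
  by_cases hbd : b = d
  · subst hbd
    rw [if_pos rfl, if_pos (Or.inl rfl), mul_zero, add_zero]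
    exact Finset.sum_eq_zero fun π _ => if_neg fun h => h.2.1 rfl
  rw [if_neg hbd]
  by_cases hq : q = b ∨ q = d
  · rw [if_pos (Or.inr hq), mul_zero, add_zero]
    refine Finset.sum_congr rfl fun π _ => ?_
    have hn : ¬((q ≠ d ∧ q ≠ b) ∧ π q = p) := fun h => hq.elim h.1.2 h.1.1
    rw [if_neg hn]
    by_cases hc : π b = a ∧ π d = c
    · rw [if_pos ⟨hc.1, Ne.symm hbd, hc.2⟩, if_pos hc, mul_one]
    · rw [if_neg (fun h => hc ⟨h.1, h.2.2⟩), if_neg hc]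
  · rw [if_neg (by tauto), Finset.mul_sum, ← Finset.sum_add_distrib]
    refine Finset.sum_congr rfl fun π _ => ?_
    have hqq : (q ≠ d ∧ q ≠ b) := ⟨fun h => hq (Or.inr h), fun h => hq (Or.inl h)⟩
    by_cases hc : π b = a ∧ π d = c
    · rw [if_pos ⟨hc.1, Ne.symm hbd, hc.2⟩, if_pos hc]
      by_cases hqp : π q = p
      · rw [if_pos ⟨hqq, hqp⟩, if_pos ⟨hc.1, hc.2, hqp⟩]; ring
      · rw [if_neg (fun h => hqp h.2), if_neg (fun h => hqp h.2.2)]; ring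
    · rw [if_neg (fun h => hc ⟨h.1, h.2.2⟩), if_neg hc, if_neg (fun h => hc ⟨h.1, h.2.1⟩)]; ring

/-- **The Hessian of `cdet` at the point, closed form** (`|ι| = m + 3`, `p ≠ q`): the entry
`((c,d),(a,b))` is `0` if `b = d` or `a = c`; otherwise it is the two-prescribed-values sum
`W(a,b,c,d; m+1)` minus `s · [q ∉ {b,d}] [p ∉ {a,c}] · W(ρa, b, ρc, d; m)` with `ρ q = p`,
`ρ = id` elsewhere (`W(·; j) = ε_K K_j + ε_Z Z_j` as in helper 2). -/
theorem hessianMatrix_cdetPoly_onePlus_apply {m : ℕ} (hι : Fintype.card ι = m + 3) {p q : ι}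
    (hpq : p ≠ q) (s : k) (a b c d : ι) :
    hessianMatrix (cdetPoly ι k) (fun ij : ι × ι => if ij = (p, q) then 1 + s else (1 : k))
        (c, d) (a, b) =
      (if b = d then 0 else if a = c then 0 else
        (if (a = b ∧ c = d) ∨ ¬((a = b ∨ c = d) ∨ (a = d ∧ c = b)) then (1 : k) else -1) *
            (if m + 1 ≤ 1 then ((m + 1 : ℕ) : k) else (-1) ^ (m + 1) * ((m + 1 - 2).factorial : k)) +
          (if a = b ∧ c = d then (2 : k) else if (a = b ∨ c = d) ∨ (a = d ∧ c = b) then -1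
            else 0) * (if m + 1 ≤ 1 then (1 : k) else 0)) +
      s * (if b = d ∨ q = b ∨ q = d then 0 else if a = p ∨ c = p then 0 else
        -(if (if a = q then p else a) = (if c = q then p else c) then 0 else
          (if ((if a = q then p else a) = b ∧ (if c = q then p else c) = d) ∨
              ¬(((if a = q then p else a) = b ∨ (if c = q then p else c) = d) ∨
                ((if a = q then p else a) = d ∧ (if c = q then p else c) = b)) then (1 : k)
            else -1) * (if m ≤ 1 then (m : k) else (-1) ^ m * ((m - 2).factorial : k)) +
          (if (if a = q then p else a) = b ∧ (if c = q then p else c) = d then (2 : k)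
            else if ((if a = q then p else a) = b ∨ (if c = q then p else c) = d) ∨
              ((if a = q then p else a) = d ∧ (if c = q then p else c) = b) then -1 else 0) *
            (if m ≤ 1 then (1 : k) else 0))) := by
  rw [hessianMatrix_cdetPoly_onePlus_eq_sum]
  congr 1
  · by_cases hbd : b = d
    · rw [if_pos hbd, if_pos hbd]
    · rw [if_neg hbd, if_neg hbd, sum_sign_mul_numCycles_apply_eq_two (m := m + 1) (by rw [hι]) hbd]
  · congr 1
    by_cases h0 : b = d ∨ q = b ∨ q = d
    · rw [if_pos h0, if_pos h0]
    · rw [if_neg h0, if_neg h0]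
      have hbd : b ≠ d := fun h => h0 (Or.inl h)
      have hbq : b ≠ q := fun h => h0 (Or.inr (Or.inl h.symm))
      have hdq : d ≠ q := fun h => h0 (Or.inr (Or.inr h.symm))
      rw [sum_three_apply_eq_swap_mul hpq hbq hdq (fun (sg : ℤ) (cy : ℕ) => (sg : k) * (cy : k))]
      by_cases hp : a = p ∨ c = p
      · rw [if_pos hp, if_pos hp]
      rw [if_neg hp, if_neg hp]
      have hρa : (if a = q then p else a) ≠ q := by
        split_ifs with h
        · exact hpq
        · exact h
      have hρc : (if c = q then p else c) ≠ q := by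
        split_ifs with h
        · exact hpq
        · exact h
      have hcond : ∀ τ : Perm {y // y ≠ q},
          (((τ ⟨b, hbq⟩ : {y // y ≠ q}) : ι) = (if a = q then p else a) ∧
            ((τ ⟨d, hdq⟩ : {y // y ≠ q}) : ι) = (if c = q then p else c)) =
          (τ ⟨b, hbq⟩ = ⟨_, hρa⟩ ∧ τ ⟨d, hdq⟩ = ⟨_, hρc⟩) := by
        intro τ
        rw [Subtype.ext_iff, Subtype.ext_iff]
      simp_rw [hcond, Int.cast_neg, neg_mul]
      rw [sum_ite_neg, sum_sign_mul_numCycles_apply_eq_two (m := m) (by rw [card_subtype_ne, hι]; omega)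
        (fun h : (⟨b, hbq⟩ : {y // y ≠ q}) = ⟨d, hdq⟩ => hbd (Subtype.ext_iff.mp h))]
      simp only [Subtype.mk.injEq]

end Summit.ValiantsHypothesis.ValiantsHypothesis.Theorems.FermionicJet.CdetHessian
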